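import Summits.RiemannHypothesis.RiemannHypothesis.Theorems.DBNDefs
import Mathlib.Algebra.Order.Field.Rat
import Mathlib.Data.Complex.Basic
import HarnessLib

/-!
# RiemannHypothesis / DBN — exact-rational certificate checker for the far-field-limit targets T6 / T6′

Route `RiemannHypothesis/DBN`, column DBN of the RH ladder (D-0040 record-keeping; cell `pub-dbn`).
Computable definitions only (generic over a field `K`; run at `K = ℚ` by `decide`, read at `K = ℝ` by
the soundness file `Theorems/DBNFarFieldCheckerSound.lean`):

* a tiny polynomial toolkit on coefficient lists (`peval`, `padd`, `psmul`, `pmul`, `pshift`, `pmk`);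
* `cpow s a n = (s + i a)^n` as a pair, `bmoment α β m = ∫_α^β (15/16)(1-v²)²(v-v₀)^m dv`
  (`v₀` the midpoint) in closed form;
* `cellPoly` / `cellRem`: for one `v`-cell `[α,β]` and one Cauchy kernel `a/(a²+s²)`, the Taylor
  polynomial in `t = ξ - ξc` of `∫_α^β φ(v) a/(a²+(ξ-κv)²) dv` obtained from the exact complex
  geometric identity `1/(z+e) = Σ_{n<N} (-e)ⁿ/zⁿ⁺¹ + (-e)ᴺ/(zᴺ(z+e))` at `z = (ξc-κv₀) - ia`,
  `e = t - κ(v-v₀)`, integrated against the exact partial biweight moments, and the bound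
  `(h+κr)ᴺ/(|z|ᴺ a)·M₀` of the remainder;
* `nearData` (sum over the cells of a partition of `[-1,1]` and over `a ∈ {c-1, c+1}`, times `2/c`),
  `qOf` (the polynomial `4 - ((ξc+t)²+4)(C(t)+ρ)`), `nearCheck` (positivity of `qOf` on `[-h,h]` by
  re-centring on `tsub` sub-intervals and the crude bound `d₀ - Σ_{k≥1}|d_k|ηᵏ > 0`);
* `farCheck`: the closed-form far-field test `m₆/X² + C₇/X³ + 256/X⁴ + C₁₀/X⁶ < Ψ₀`,
  `Ψ₀ = 4(c²-1-3κ²/7)`, from the same expansion with `N = 6` on the whole cell `[-1,1]`;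
* `Cert`, `checkCert`: a certificate = `(c, κ, partition, near-field intervals, far threshold X)`.

Soundness (`checkCert cert = true → FarFieldLimitAdmissible1D cert.c cert.κ`) is proved in the
sibling file; the 14 certificates are in `Theorems/DBNFarFieldLimitPairs.lean`.  RH-FREE bookkeeping
(`--supports stmt-RiemannHypothesis-0274`); nothing here bears on the truth of RH.
-/

-- D-0017: `Summit.<S>.<S>.…` is the designed namespace of a single-problem summit.
set_option linter.dupNamespace false

namespace Summit.RiemannHypothesis.RiemannHypothesis.Theorems.DbnTheory

namespace FarField

variable {K : Type*}

section Poly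
variable [Field K]

/-- Evaluate a coefficient list (constant term first) at `x`. -/
def peval : List K → K → K
  | [], _ => 0
  | a :: p, x => a + x * peval p x

/-- Sum of two coefficient lists. -/
def padd : List K → List K → List K
  | [], q => q
  | a :: p, [] => a :: p
  | a :: p, b :: q => (a + b) :: padd p q

/-- Scalar multiple of a coefficient list. -/
def psmul (c : K) : List K → List K
  | [] => []
  | a :: p => (c * a) :: psmul c p

/-- Product of two coefficient lists. -/
def pmul : List K → List K → List K
  | [], _ => []
  | a :: p, q => padd (psmul a q) (0 :: pmul p q)

/-- Coefficients of `p(t₀ + X)`. -/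
def pshift (t0 : K) : List K → List K
  | [] => []
  | a :: p => padd [a] (pmul [t0, 1] (pshift t0 p))

/-- The list `[f i, f (i+1), …, f (i+m-1)]`. -/
def pmk (f : ℕ → K) : ℕ → ℕ → List K
  | _, 0 => []
  | i, m + 1 => f i :: pmk f (i + 1) m

/-- `Σ_{k} |p_k| η^k` over the list (used with the tail of a re-centred polynomial). -/
def pabs [LinearOrder K] : List K → K → K
  | [], _ => 0
  | a :: p, η => |a| + η * pabs p η

end Poly

section Kernel
variable [Field K]

/-- `(s + i·a)^n` as the pair `(re, im)`, by the multiplication recurrence. -/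
def cpow (s a : K) : ℕ → K × K
  | 0 => (1, 0)
  | n + 1 => ((cpow s a n).1 * s - (cpow s a n).2 * a, (cpow s a n).1 * a + (cpow s a n).2 * s)

/-- `∫_{-r}^{r} w^k dw = (r^(k+1) - (-r)^(k+1))/(k+1)`. -/
def monoInt (r : K) (k : ℕ) : K := (r ^ (k + 1) - (-r) ^ (k + 1)) / ((k : K) + 1)

/-- The partial biweight moment `∫_α^β (15/16)(1-v²)² (v-v₀)^m dv`, `v₀ = (α+β)/2`, in closed form
(substitute `w = v - v₀`, expand `(1-(w+v₀)²)² = Σ_{i≤4} e_i w^i`). -/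
def bmoment (α β : K) (m : ℕ) : K :=
  (15 / 16) * ( (1 - ((α + β) / 2) ^ 2) ^ 2 * monoInt ((β - α) / 2) m
    + (-4 * (1 - ((α + β) / 2) ^ 2) * ((α + β) / 2)) * monoInt ((β - α) / 2) (m + 1)
    + (4 * ((α + β) / 2) ^ 2 - 2 * (1 - ((α + β) / 2) ^ 2)) * monoInt ((β - α) / 2) (m + 2)
    + (4 * ((α + β) / 2)) * monoInt ((β - α) / 2) (m + 3)
    + monoInt ((β - α) / 2) (m + 4) )

/-- Taylor coefficient `Im((s₀ - ia)^{-(n+1)}) = Im((s₀ + ia)^{n+1})/(s₀²+a²)^{n+1}`. -/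
def tcoef (s0 a : K) (n : ℕ) : K := (cpow s0 a (n + 1)).2 / (s0 ^ 2 + a ^ 2) ^ (n + 1)

/-- Coefficient list (in `t`) of `∫_α^β φ(v) (κ(v-v₀) - t)^n dv = Σ_j C(n,j)(-1)^j κ^{n-j} M_{n-j} t^j`. -/
def qpoly (κ α β : K) (n : ℕ) : List K :=
  pmk (fun j => ((n.choose j : ℕ) : K) * (-1) ^ j * κ ^ (n - j) * bmoment α β (n - j)) 0 (n + 1)

/-- Taylor polynomial (in `t`, `N` terms) of `∫_α^β φ(v) a/(a²+(ξc+t-κv)²) dv`. -/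
def cellPoly (a κ α β xc : K) : ℕ → List K
  | 0 => []
  | n + 1 => padd (cellPoly a κ α β xc n) (psmul (tcoef (xc - κ * ((α + β) / 2)) a n) (qpoly κ α β n))

/-- Bound of the Taylor remainder of the cell integral, uniform in `|t| ≤ h`:
`(h + κ(β-α)/2)^{2N'}/((s₀²+a²)^{N'} a) · M₀`. -/
def cellRem (a κ α β xc h : K) (N' : ℕ) : K :=
  (h + κ * ((β - α) / 2)) ^ (2 * N') /
      (((xc - κ * ((α + β) / 2)) ^ 2 + a ^ 2) ^ N' * a) * bmoment α β 0

/-- The cells `[(p₀,p₁), (p₁,p₂), …]` of a partition given by its points. -/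
def cellsOf : List K → List (K × K)
  | a :: b :: rest => (a, b) :: cellsOf (b :: rest)
  | _ => []

/-- Near-field data of one `ξ`-interval: the polynomial `C(t)` and the remainder bound `ρ` with
`(2/c)·S_{c,κ}(ξc+t,1) ≤ C(t) + ρ` for `|t| ≤ h` (sum over the cells and over `a ∈ {c-1,c+1}`). -/
def nearData (c κ : K) (N' : ℕ) (xc h : K) : List (K × K) → List K × K
  | [] => ([], 0)
  | (α, β) :: rest =>
      ( padd (psmul (2 / c) (padd (cellPoly (c - 1) κ α β xc (2 * N')) (cellPoly (c + 1) κ α β xc (2 * N'))))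
          (nearData c κ N' xc h rest).1,
        (2 / c) * (cellRem (c - 1) κ α β xc h N' + cellRem (c + 1) κ α β xc h N')
          + (nearData c κ N' xc h rest).2 )

/-- The polynomial `q(t) = 4 - ((ξc+t)²+4)·(C(t)+ρ)`. -/
def qOf (xc : K) (C : List K) (ρ : K) : List K :=
  padd [4] (psmul (-1) (pmul [xc ^ 2 + 4, 2 * xc, 1] (padd C [ρ])))

/-- One near-field `ξ`-interval of a certificate: centre, half-width, Taylor half-order `N'`
(`2N'` terms), number of `t`-sub-intervals. -/
structure NearIv (K : Type*) where
  /-- centre `ξc` -/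
  xc : K
  /-- half-width `h` -/
  h : K
  /-- Taylor half-order (`2N'` terms) -/
  N' : ℕ
  /-- number of `t`-sub-intervals for the positivity test -/
  tsub : ℕ

/-- Positivity test of `q` on the `i`-th of `tsub` sub-intervals of `[-h,h]`: re-centre at
`t_c = -h + (2i+1)η`, `η = h/tsub`, and require `η·Σ_{k≥1}|d_k|η^{k-1} < d₀`. -/
def subCheck [LinearOrder K] (q : List K) (h : K) (tsub i : ℕ) : Bool :=
  match pshift (-h + (2 * (i : K) + 1) * (h / (tsub : K))) q with
  | [] => false
  | d0 :: d => decide ((h / (tsub : K)) * pabs d (h / (tsub : K)) < d0)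

/-- The near-field test of one interval. -/
def nearCheck [LinearOrder K] (c κ : K) (pts : List K) (iv : NearIv K) : Bool :=
  decide (0 < iv.tsub) && decide (0 ≤ iv.h) &&
    (List.range iv.tsub).all (fun i =>
      subCheck (qOf iv.xc (nearData c κ iv.N' iv.xc iv.h (cellsOf pts)).1
        (nearData c κ iv.N' iv.xc iv.h (cellsOf pts)).2) iv.h iv.tsub i)

/-- Far-field constants (expansion with `N = 6` on the whole cell, `ξ ≥ X ≥ 2κ`):
`Ψ₀ = -16 - c₄`, `m₆ = max 0 (C₆' - 64)`, `C₇`, `C₁₀`. -/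
def farPsi (c κ : K) : K :=
  -16 - (2 / c) * (3 * κ ^ 2 / 7 * ((c - 1) + (c + 1)) - ((c - 1) ^ 3 + (c + 1) ^ 3))

/-- see `farPsi` -/
def farM6 [LinearOrder K] (c κ : K) : K :=
  max 0 ((2 / c) * (((c - 1) ^ 5 + (c + 1) ^ 5) + 5 * κ ^ 4 / 21 * ((c - 1) + (c + 1))) - 64)

/-- see `farPsi` -/
def farC7 (c κ : K) : K := (2 / c) * (2 * (10 * κ ^ 6 / 231))

/-- see `farPsi` -/
def farC10 (c κ : K) : K := (2 / c) * (κ ^ 4 / 21 * ((c - 1) ^ 5 + (c + 1) ^ 5))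

/-- The far-field test at threshold `X`. -/
def farCheck [LinearOrder K] (c κ X : K) : Bool :=
  decide (2 * κ ≤ X) && decide (0 < X) &&
    decide (farM6 c κ / X ^ 2 + farC7 c κ / X ^ 3 + 256 / X ^ 4 + farC10 c κ / X ^ 6 < farPsi c κ)

/-- Partition test: strictly increasing and ends at `1` (the start `-1` is tested separately). -/
def ptsCheck [LinearOrder K] : List K → Bool
  | [] => false
  | [a] => decide (a = 1)
  | a :: b :: rest => decide (a < b) && ptsCheck (b :: rest)

/-- Coverage test: consecutive intervals leave no gap from `lo` up to `X`. -/
def coverCheck [LinearOrder K] (X : K) : K → List (NearIv K) → Bool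
  | lo, [] => decide (X ≤ lo)
  | lo, iv :: rest => decide (iv.xc - iv.h ≤ lo) && coverCheck X (iv.xc + iv.h) rest

end Kernel

/-- A far-field-limit certificate for one pair `(c, κ)`. -/
structure Cert where
  /-- probe height `c` -/
  c : ℚ
  /-- smear half-width `κ` -/
  κ : ℚ
  /-- partition points of `[-1,1]` -/
  pts : List ℚ
  /-- near-field intervals covering `[0, X]` -/
  ivs : List (NearIv ℚ)
  /-- far-field threshold -/
  X : ℚ

/-- The certificate checker (run by `decide`). -/
def checkCert (cert : Cert) : Bool :=
  decide (1 < cert.c) && decide (0 < cert.κ) && decide (cert.pts.head? = some (-1)) &&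
    ptsCheck cert.pts && coverCheck cert.X 0 cert.ivs && farCheck cert.c cert.κ cert.X &&
    cert.ivs.all (nearCheck cert.c cert.κ cert.pts)

end FarField

end Summit.RiemannHypothesis.RiemannHypothesis.Theorems.DbnTheory
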